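import Summits.Parity.GeneralizedHardyLittlewood.Theorems.BeyondDiagonalBeatsQuarter.OmegaWindow
import HarnessLib

/-!
# Route `PrimeLevelFamEdge`, crux K_B (stmt-Parity-20343), line `diagonal_kernel_split`:
# F2 V3 — the plan-Ω exponent window with the `d₃` tiny-part loss row (still NON-EMPTY)

Continuation of `OmegaWindow.lean` (V1 p626184, V2 p629549; that file is at the 400-line cap, so V3 lives
here). ls-ref-1 g17's W3 read (c), note N1′ (ABL arXiv:2005.13915 p. 23 L13–16): the `d₃`-shapes lose
`x^{C_id·ηV}` (`C_id = 10`) from the tiny factors, so the `d₃` saving row couples the type-II parameter `ηV` to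
`δ_FT`. Same quantifier order as V1/V2 (that of `kernelExcessBelowSlack_io_of_blockAtCleanScales`). Bookkeeping,
not analysis; standard axioms.
«The programme SEARCHES and TYPES; no claim about Landau–Siegel zeros, Theorems 1–2 of arXiv:2211.02515 or
a repaired Margin232 until a kernel theorem says so.»
-/

namespace Summit.Parity.GeneralizedHardyLittlewood.Theorems.BeyondDiagonalBeatsQuarter

/-! ## V3 (2026-08-28, lead g9): the `d₃` tiny-part loss (ls-ref-1 g17 W3 read (c), N1′; ABL p. 23 L13–16)

The `d₃`-in-AP input loses `x^{C_id·ηV}` from the tiny parts of the Heath-Brown decomposition (`C_id = 10` in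
ABL's bookkeeping); the row `ft_saving` therefore reads `κ₀η + ε + C_id·ηV < δ_FT`, which couples the type-II
parameter `ηV` to the `d₃` saving. The window stays NON-EMPTY with `ηV := min (min ηA 1/16) (δFT/(2 C_id))`
(`omegaWindowV3_nonempty`). -/

/-- **OmegaAdmissible V3** = V2 plus the tiny-part loss row `ft_saving'` : `κ₀(Δ′−1) + ε + C_id·ηV < δFT`
(ABL p. 23: the `d₃` shapes carry a loss `x^{C_id ηV}` from the tiny factors).
[cite: AssingBlomerLi2020, §4 p. 23 (the d₃-shapes and the tiny-part loss)] -/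
structure OmegaAdmissibleV3 (ηA δA η₀ ηZ CR cR δFT Cid a₀ ηV Δ' κ₀ U ε ε₁ σ δ η' : ℝ) : Prop
    extends OmegaAdmissibleV2 ηA δA η₀ ηZ CR cR δFT a₀ ηV Δ' κ₀ U ε ε₁ σ δ η' where
  /-- N1′: bulk enhancement + losses + tiny-part loss `C_id·ηV` below the `d₃`-in-AP saving `δFT`. -/
  ft_saving' : κ₀ * (Δ' - 1) + ε + Cid * ηV < δFT

/-- **F2 V3: still NON-EMPTY** (same quantifier order; printed constants now include `δFT, C_id > 0`).
Witnesses: `ηV = min (min ηA 1/16) (δFT/(2C_id))`, `a₀ = 2C_R/c_R`, `m = min (min (min δA η₀) (min ηZ 1/100)) δFT`,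
`b = 1 + m/100`; on the window `U = 2η`, `ε = m/200`, `ε₁ = σ = m`, `δ = m/2`, `η′ = 3m/4`.
[cite: AssingBlomerLi2020, Proposition 4.1 p. 17 and §4 p. 23; MontgomeryVaughan2007, Cor. 11.10 (Page)] -/
theorem omegaWindowV3_nonempty {ηA ηZ CR cR δFT Cid : ℝ} (hηA : 0 < ηA) (hηZ : 0 < ηZ) (hCR : 0 < CR)
    (hcR : 0 < cR) (hδFT : 0 < δFT) (hCid : 0 < Cid) {δABL : ℝ → ℝ}
    (hδABL : ∀ ηV : ℝ, 0 < ηV → ηV ≤ ηA → 0 < δABL ηV) :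
    ∃ ηV : ℝ, 0 < ηV ∧ ηV ≤ ηA ∧ ∃ a₀ : ℝ, 0 < a₀ ∧ ∀ η₀ : ℝ, 0 < η₀ →
      ∃ b : ℝ, 1 < b ∧ b < 2 ∧ ∀ Δ' : ℝ, 1 < Δ' → Δ' < b → ∀ κ₀ : ℝ, 1 / 2 ≤ κ₀ → κ₀ ≤ 1 →
        ∃ U ε ε₁ σ δ η' : ℝ,
          OmegaAdmissibleV3 ηA (δABL ηV) η₀ ηZ CR cR δFT Cid a₀ ηV Δ' κ₀ U ε ε₁ σ δ η' := by
  set ηV : ℝ := min (min ηA (1 / 16)) (δFT / (2 * Cid)) with hηV_def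
  have hηV_pos : 0 < ηV := lt_min (lt_min hηA (by norm_num)) (by positivity)
  have hηV_le : ηV ≤ ηA := (min_le_left _ _).trans (min_le_left _ _)
  have hηV_16 : ηV ≤ 1 / 16 := (min_le_left _ _).trans (min_le_right _ _)
  have hηV_FT : ηV ≤ δFT / (2 * Cid) := min_le_right _ _
  have hCidηV : Cid * ηV ≤ δFT / 2 := by
    have := mul_le_mul_of_nonneg_left hηV_FT hCid.le
    rw [mul_div_assoc'] at this
    calc Cid * ηV ≤ Cid * δFT / (2 * Cid) := this
      _ = δFT / 2 := by field_simp
  have hδA : 0 < δABL ηV := hδABL ηV hηV_pos hηV_le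
  set a₀ : ℝ := 2 * CR / cR with ha₀_def
  have ha₀_pos : 0 < a₀ := by positivity
  have hdamp : CR * Real.exp (-(cR * a₀)) < 1 := by
    have hca : cR * a₀ = 2 * CR := by rw [ha₀_def]; field_simp
    rw [hca]
    have h1 : 2 * CR + 1 ≤ Real.exp (2 * CR) := by
      have := Real.add_one_le_exp (2 * CR); linarith
    have hprod : Real.exp (-(2 * CR)) * (2 * CR + 1) ≤ 1 := by
      calc Real.exp (-(2 * CR)) * (2 * CR + 1)
          ≤ Real.exp (-(2 * CR)) * Real.exp (2 * CR) :=
            mul_le_mul_of_nonneg_left h1 (Real.exp_pos _).le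
        _ = 1 := by rw [← Real.exp_add]; simp
    nlinarith [Real.exp_pos (-(2 * CR)), hprod, hCR]
  refine ⟨ηV, hηV_pos, hηV_le, a₀, ha₀_pos, fun η₀ hη₀ ↦ ?_⟩
  set m : ℝ := min (min (min (δABL ηV) η₀) (min ηZ (1 / 100))) δFT with hm_def
  have hm_pos : 0 < m := lt_min (lt_min (lt_min hδA hη₀) (lt_min hηZ (by norm_num))) hδFT
  have hm₁ : m ≤ min (min (δABL ηV) η₀) (min ηZ (1 / 100)) := min_le_left _ _
  have hm_δFT : m ≤ δFT := min_le_right _ _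
  have hm_δA : m ≤ δABL ηV := hm₁.trans ((min_le_left _ _).trans (min_le_left _ _))
  have hm_η₀ : m ≤ η₀ := hm₁.trans ((min_le_left _ _).trans (min_le_right _ _))
  have hm_ηZ : m ≤ ηZ := hm₁.trans ((min_le_right _ _).trans (min_le_left _ _))
  have hm_100 : m ≤ 1 / 100 := hm₁.trans ((min_le_right _ _).trans (min_le_right _ _))
  refine ⟨1 + m / 100, by linarith, by linarith, fun Δ' h1 h2 κ₀ hκ₁ hκ₂ ↦ ?_⟩
  have hη : 0 < Δ' - 1 := by linarith
  have hηm : Δ' - 1 < m / 100 := by linarith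
  have hκη : κ₀ * (Δ' - 1) ≤ Δ' - 1 := by nlinarith
  have hκη' : κ₀ * (Δ' - 1) + m / 200 < 3 * m / 200 := by linarith
  refine ⟨2 * (Δ' - 1), m / 200, m, m, m / 2, 3 * m / 4, ?_, ?_⟩
  · refine ⟨?_, ?_, ?_, ?_⟩
    · constructor
      · exact h1
      · linarith
      · rw [lt_div_iff₀ (by linarith)]; linarith
      · exact ha₀_pos
      · rw [lt_div_iff₀ (by linarith)]; nlinarith
      · have := mul_lt_mul_of_pos_left (show CR * Real.exp (-(cR * a₀)) < 2 by linarith) hη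
        linarith
      · positivity
      · linarith
      · linarith
      · linarith
      · positivity
      · linarith
      · linarith
      · positivity
      · linarith
      · linarith
      · linarith
      · exact hηV_pos
      · exact hηV_le
      · linarith
      · positivity
      · linarith
      · linarith
      · linarith
    · linarith
    · linarith
    · linarith
  · linarith

end Summit.Parity.GeneralizedHardyLittlewood.Theorems.BeyondDiagonalBeatsQuarter
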